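import Summits.RiemannHypothesis.RiemannHypothesis.Theses.WeilComb
import Summits.RiemannHypothesis.RiemannHypothesis.Theorems.WeilCombCombShapePositivityStubWindowMellin
import Summits.RiemannHypothesis.RiemannHypothesis.Theorems.WeilCombCombShapePositivityStubWindowNorm
import Summits.RiemannHypothesis.RiemannHypothesis.Theorems.WeilCombCombShapePositivityStubSubDiagPole
import Summits.RiemannHypothesis.RiemannHypothesis.Theorems.WeilCombCombShapePositivityStubOffdiagSchur
import Summits.RiemannHypothesis.RiemannHypothesis.Theorems.WeilCombCombShapePositivityStubPoincareEta
import Summits.RiemannHypothesis.RiemannHypothesis.Theorems.WeilCombCombShapePositivityStubArchBathtub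
import Summits.RiemannHypothesis.RiemannHypothesis.Theorems.WeilCombCombShapePositivityHelsonPotentialLegendre
import Summits.RiemannHypothesis.RiemannHypothesis.Theorems.WeilCombCombShapePositivityAssembleInv20
import Summits.RiemannHypothesis.RiemannHypothesis.Theorems.WeilCombCombShapePositivityBumpConstants
import Summits.RiemannHypothesis.RiemannHypothesis.Theorems.WeilCombCombShapePositivityExactPrimeWindow
import Summits.RiemannHypothesis.RiemannHypothesis.Theorems.WeilCombCombShapePositivityPolarExact
import Summits.RiemannHypothesis.RiemannHypothesis.Theorems.WeilCombCombShapePositivityArchGram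
import Summits.RiemannHypothesis.RiemannHypothesis.Theorems.WeilCombCombShapePositivityWindowDichotomy
import Summits.RiemannHypothesis.RiemannHypothesis.Theorems.WeilCombCombShapeAdmissible
import Summits.RiemannHypothesis.RiemannHypothesis.Theorems.WeilCombCombSubcriticalStubIdentity
import Summits.RiemannHypothesis.RiemannHypothesis.Theorems.WeilCombCombSubcriticalEffectiveAux
import Literature.NumberTheory.LFunctions.WeilExplicit
import Literature.NumberTheory.LFunctions.WeilMellinBounds
import Literature.NumberTheory.LFunctions.WeilArchimedeanMoments
import Literature.NumberTheory.LFunctions.WeilArchimedeanPositivityProofs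
import Literature.NumberTheory.LFunctions.WeilGroundEnergyProofs
import Mathlib.NumberTheory.Harmonic.Bounds

/-!
# The effective window `εM ≤ 1/20` of Theorem B, and `stub_windowCore` on the sub-band `1/40 < εM ≤ 1/20`
(crux `WeilComb.CombShapePositivity`, item stmt-RiemannHypothesis-11229, line `Sketch`)

Notation. `φ₀(u) = expNegInvGlue (1 - u²)`, `φ_ε(t) = ε⁻¹ φ₀(t/ε)`, `ψ_ε = φ_ε ⋆ φ̃_ε`, comb
`g = Σ_{m ≤ M} a_m φ_ε(· − log m)`, `Q(g) = W(g ⋆ g̃)`, `N = ‖φ₀‖₂²`, `I = ∫ φ₀`, `U = ε⁻¹N`, `L = Σ ‖a_m‖²`.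

* `combWindow_le_inv20` — **for `ε > 0`, every `M`, `a` with `εM ≤ 1/20`: `0 ≤ Re Q(g)`** (unconditional; extends the
  landed effective windows `εM ≤ 1/128` (`stub_windowSub`, p103822), `εM ≤ 1/25` (`combWindow_le_inv25`) and the
  skeleton-glued `εM ≤ 1/40`). Architecture of the skeleton's `stub_windowSub40` (exact identity, polar identity,
  archimedean Gram form, `H = V − D`, landed stubs `stub_offdiagSchur`, `stub_poincareEta`, `stub_archBathtub`,
  `stub_subDiagPole` (b)) with TWO new ingredients: the Helson potential constant `3/20` (`helsonPotential_le_three_twentieths`)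
  and the certified bump ratio `I₀² ≤ (153/100) N₀` (`integral_shapeBump_sq_le`), assembled by `assemble_inv20` (`θ = 8/5`, `η = 5`).
* `stub_windowCore_of_le_inv20` — the band residual `stub_windowCore` of the skeleton (signed normal form
  `U(H + log π·L) ≤ 2Re(φ̂_ε(0) conj φ̂_ε(1)·A₋ conj A₊) + (1/2π)∫|φ̂_ε(1/2+it)|²|D_a(t)|² Re ψ(1/4+it/2) dt`)
  on the sub-band `εM ≤ 1/20`, by reversing the glue of `stub_window` (W1 `stub_windowMellin`, W2 `stub_windowNorm`,
  `weilArchIntegral_weilConv_weilReflect`). What remains of `stub_windowCore` is the band `1/20 < εM ≤ M/(2(M+1))`.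
-/

noncomputable section

-- the sub-problem path `RiemannHypothesis/RiemannHypothesis` (single-conjunct summit, D-0017) duplicates a namespace
set_option linter.dupNamespace false

open scoped BigOperators ComplexConjugate
open Complex MeasureTheory

namespace Summit.RiemannHypothesis.RiemannHypothesis.Theorems.WeilCombBohrFejer

open Literature.NumberTheory.LFunctions

/-- `weilNorm1 φ₀ = ∫ φ₀` (the bump is real and nonnegative). [folklore] -/
private theorem weilNorm1_shapeBump_w20 :
    weilNorm1 (fun u : ℝ => ((expNegInvGlue (1 - u ^ 2) : ℝ) : ℂ)) = ∫ u : ℝ, expNegInvGlue (1 - u ^ 2) := by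
  unfold weilNorm1
  congr 1 with u
  rw [Complex.norm_real, Real.norm_eq_abs, abs_of_nonneg (expNegInvGlue.nonneg _)]

/-- `I = ∫ φ₀ > 0`. [folklore] -/
private theorem integral_shapeBump_pos_w20 : 0 < ∫ u : ℝ, expNegInvGlue (1 - u ^ 2) := by
  have hc : Continuous fun u : ℝ => expNegInvGlue (1 - u ^ 2) :=
    (expNegInvGlue.contDiff (n := 0)).continuous.comp (continuous_const.sub (continuous_id.pow 2))
  have hs : HasCompactSupport fun u : ℝ => expNegInvGlue (1 - u ^ 2) := by
    refine HasCompactSupport.of_support_subset_isCompact (isCompact_Icc (a := -1) (b := 1)) ?_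
    intro u hu
    by_contra h
    apply hu
    have h1 : 1 - u ^ 2 ≤ 0 := by
      simp only [Set.mem_Icc, not_and_or, not_le] at h
      rcases h with h | h <;> nlinarith
    exact expNegInvGlue.zero_of_nonpos h1
  exact hc.integral_pos_of_hasCompactSupport_nonneg_nonzero hs (fun u => expNegInvGlue.nonneg _) (x := 0)
    (expNegInvGlue.pos_of_pos (by norm_num)).ne'

/-- `Σ_{m ≤ M} 1/m ≤ 1 + log M` (real form of `harmonic_le_one_add_log`). [folklore] -/
private theorem sum_Icc_inv_le_w20 (M : ℕ) :
    ∑ m ∈ Finset.Icc 1 M, ((m : ℝ))⁻¹ ≤ 1 + Real.log M := by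
  have hH := harmonic_le_one_add_log M
  simp_rw [harmonic_eq_sum_Icc, Rat.cast_sum, Rat.cast_inv, Rat.cast_natCast] at hH
  exact hH

/-- **EFFECTIVE WINDOW `εM ≤ 1/20`.** For `ε > 0`, `M`, `a` with `εM ≤ 1/20` the fixed-shape comb has
`0 ≤ Re Q(g)`.  `M = 0`: `Q(0) = 0`.  `M ≥ 1`: `Re Q = Re P − ε⁻¹N·H + Re W_∞(k)` (exact window identity);
`Re P ≥ −2|φ̂_ε(0)||φ̂_ε(1)| ‖A₋‖ ‖A₊‖` with `‖A₋‖² ≤ (1 + log M)L`, `‖A₊‖² ≤ M Q₁`; `Re W_∞(k) = L·Re W_∞(ψ_ε) + Off`;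
`H = V − D`; the landed stubs `stub_offdiagSchur`, `stub_poincareEta`, `stub_archBathtub`, `stub_subDiagPole` (b);
the Helson potential with constant `3/20`; the bump ratio `I² ≤ (153/100)N`; and the budget `assemble_inv20`. [folklore] -/
theorem combWindow_le_inv20 : ∀ ε : ℝ, 0 < ε → ∀ (M : ℕ) (a : ℕ → ℂ), ε * M ≤ 1 / 20 →
    0 ≤ (weilQuadratic (fun x : ℝ => ∑ m ∈ Finset.Icc 1 M,
        a m * ((ε : ℂ)⁻¹ * ((expNegInvGlue (1 - ((x - Real.log (m : ℝ)) / ε) ^ 2) : ℝ) : ℂ)))).re := by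
  intro ε hε M a hlam
  rcases Nat.eq_zero_or_pos M with hM0 | hMpos
  · subst hM0
    have h0 : (fun x : ℝ => ∑ m ∈ Finset.Icc 1 0,
        a m * ((ε : ℂ)⁻¹ * ((expNegInvGlue (1 - ((x - Real.log (m : ℝ)) / ε) ^ 2) : ℝ) : ℂ))) = 0 := by
      funext x
      simp
    rw [h0, weilQuadratic_zero]
    simp
  have hM : 1 ≤ M := hMpos
  have hMr : (1 : ℝ) ≤ (M : ℝ) := by exact_mod_cast hM
  have hMr0 : (0 : ℝ) < (M : ℝ) := by linarith
  have hε20 : ε ≤ 1 / 20 := by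
    have : ε * 1 ≤ ε * M := mul_le_mul_of_nonneg_left hMr hε.le
    linarith
  have hwlt : 2 * ε * ((M : ℝ) + 1) < 1 := by
    have e : 2 * ε * ((M : ℝ) + 1) = 2 * (ε * M) + 2 * ε := by ring
    rw [e]; linarith
  have hw : 2 * ε * ((M : ℝ) + 1) ≤ 1 := hwlt.le
  -- names
  set φε : ℝ → ℂ := fun t : ℝ => (ε : ℂ)⁻¹ * ((expNegInvGlue (1 - (t / ε) ^ 2) : ℝ) : ℂ) with hφε
  set ψε : ℝ → ℂ := weilConv φε (weilReflect φε) with hψε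
  set N : ℝ := weilNorm2Sq (fun u : ℝ => ((expNegInvGlue (1 - u ^ 2) : ℝ) : ℂ)) with hN
  set I : ℝ := ∫ u : ℝ, expNegInvGlue (1 - u ^ 2) with hI
  set L : ℝ := ∑ m ∈ Finset.Icc 1 M, ‖a m‖ ^ 2 with hL
  set H : ℝ := 2 * (∑ m ∈ Finset.Icc 1 M, ∑ n ∈ Finset.Icc 1 (M / m),
      ((ArithmeticFunction.vonMangoldt n : ℝ) : ℂ) / (Real.sqrt n : ℂ) * a (n * m) *
        conj (a m)).re with hH
  set V : ℝ := ∑ m ∈ Finset.Icc 1 M, ‖a m‖ ^ 2 *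
      (Real.log m + ∑ n ∈ Finset.Icc 1 (M / m), (ArithmeticFunction.vonMangoldt n : ℝ) / n) with hV
  set D : ℝ := ∑ m ∈ Finset.Icc 1 M, ∑ n ∈ Finset.Icc 1 (M / m),
      (ArithmeticFunction.vonMangoldt n : ℝ) * ‖a (n * m) - ((Real.sqrt n : ℂ))⁻¹ * a m‖ ^ 2 with hD
  set Qp : ℝ := ∑ m ∈ Finset.Icc 1 M, (m : ℝ) * Real.log m * ‖a m‖ ^ 2 with hQp
  set Q1 : ℝ := ∑ m ∈ Finset.Icc 1 M, (m : ℝ) * ‖a m‖ ^ 2 with hQ1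
  set Aminus : ℂ := ∑ m ∈ Finset.Icc 1 M, a m * ((Real.sqrt (m : ℝ) : ℝ) : ℂ)⁻¹ with hAminus
  set Aplus : ℂ := ∑ m ∈ Finset.Icc 1 M, a m * ((Real.sqrt (m : ℝ) : ℝ) : ℂ) with hAplus
  set F0 : ℝ := ‖weilMellin φε 0‖ with hF0
  set F1 : ℝ := ‖weilMellin φε 1‖ with hF1
  set Wd : ℝ := (weilArchTerm ψε).re with hWd
  set Off : ℝ := (∑ m ∈ Finset.Icc 1 M, ∑ m' ∈ (Finset.Icc 1 M).erase m,
      a m * conj (a m') * weilArchTerm (weilTranslate ψε (Real.log (m : ℝ) - Real.log (m' : ℝ)))).re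
    with hOff
  -- basic facts on the bump
  have hφ : IsWeilTest (fun u : ℝ => ((expNegInvGlue (1 - u ^ 2) : ℝ) : ℂ)) :=
    Summit.RiemannHypothesis.RiemannHypothesis.Theorems.weilComb_shapeBump_isWeilTest
  have hNpos : 0 < N := weilNorm2Sq_shapeBump_pos
  have hIpos : 0 < I := integral_shapeBump_pos_w20
  obtain ⟨-, hcoef, -⟩ := stub_subDiagPole
  obtain ⟨hF0le, hF1le⟩ := hcoef ε hε
  have hI2 : I ^ 2 ≤ 153 / 100 * N := integral_shapeBump_sq_le
  -- the Weil test `φ_ε`, its norms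
  have hφεW : IsWeilTest φε := isWeilTest_dil hφ hε.ne'
  have hn2 : weilNorm2Sq φε = ε⁻¹ * N := by
    rw [hφε, hN]
    exact weilNorm2Sq_dil (fun u : ℝ => ((expNegInvGlue (1 - u ^ 2) : ℝ) : ℂ)) hε
  have hn1 : weilNorm1 φε = I := by
    rw [hφε, hI, ← weilNorm1_shapeBump_w20]
    exact weilNorm1_dil (fun u : ℝ => ((expNegInvGlue (1 - u ^ 2) : ℝ) : ℂ)) hε
  -- Step 1: exact window identity, polar identity, archimedean Gram form, Helson identity
  have h1 := weilQuadratic_comb_re_exactWindow ε hε M a hM hw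
  have h2 := weilPolarTerm_comb_re ε hε M a
  have h3 := weilArchTerm_comb_eq_sum ε hε M a
  have hId := Summit.RiemannHypothesis.RiemannHypothesis.Theorems.WeilCombSubcritical.stub_identity M a
  -- Step 2: the analytic stubs
  have hexp4 : (Real.exp (4 * ε) - 1) * M < 2 := by
    have hx : 4 * ε ≤ 4 / 20 := by linarith
    have he : Real.exp (4 * ε) ≤ 1 + 4 * ε + (4 * ε) ^ 2 := by
      have h0 : |4 * ε| ≤ 1 := by
        rw [abs_of_pos (by positivity)]
        linarith
      have h' := (abs_le.1 (Real.abs_exp_sub_one_sub_id_le h0)).2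
      linarith
    have h4M : 4 * ε * M ≤ 4 / 20 := by
      have : 4 * ε * (M : ℝ) = 4 * (ε * M) := by ring
      rw [this]
      linarith
    have hA : (Real.exp (4 * ε) - 1) * M ≤ (4 * ε + (4 * ε) ^ 2) * M :=
      mul_le_mul_of_nonneg_right (by linarith) hMr0.le
    have hB : (4 * ε + (4 * ε) ^ 2) * (M : ℝ) = 4 * ε * M + 4 * ε * (4 * ε * M) := by ring
    have hC : 4 * ε * (4 * ε * M) ≤ 4 * ε * (4 / 20) := mul_le_mul_of_nonneg_left h4M (by positivity)
    have hC' : 4 * ε * (4 / 20 : ℝ) ≤ 4 / 20 * (4 / 20) := mul_le_mul_of_nonneg_right hx (by norm_num)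
    linarith
  have hlog : 2 * ε < Real.log (1 + 1 / (M : ℝ)) := by
    -- `log(1 + x) ≥ x/(1+x) = 1/(M+1) > 2ε`
    have h1' : 1 / ((M : ℝ) + 1) ≤ Real.log (1 + 1 / (M : ℝ)) := by
      have := Real.one_sub_inv_le_log_of_pos (x := 1 + 1 / (M : ℝ)) (by positivity)
      have e : 1 - (1 + 1 / (M : ℝ))⁻¹ = 1 / ((M : ℝ) + 1) := by
        field_simp
        ring
      linarith [e ▸ this]
    have h2' : 2 * ε < 1 / ((M : ℝ) + 1) := by
      rw [lt_div_iff₀ (by positivity)]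
      exact hwlt
    linarith
  have hOff' := stub_offdiagSchur ε hε M a hM hexp4 hlog
  have hPoinc := stub_poincareEta M a
  have hV' := helsonPotential_le_three_twentieths M a
  have hbath : ε⁻¹ * N * (Real.log (ε⁻¹ * N / (2 * I ^ 2)) - 1) - 21 / (5 * Real.pi) * I ^ 2 ≤ Wd := by
    have hn1pos : 0 < weilNorm1 φε := by rw [hn1]; exact hIpos
    have hcond : 2 * weilNorm1 φε ^ 2 ≤ Real.pi * weilNorm2Sq φε := by
      rw [hn1, hn2]
      -- `2 I² ≤ 3.06 N ≤ π N/ε` since `ε ≤ 1/20`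
      have hπ : (3 : ℝ) < Real.pi := Real.pi_gt_three
      have hinv : (20 : ℝ) ≤ ε⁻¹ := by
        rw [le_inv_comm₀ (by norm_num) hε]
        linarith
      have hI2' : I ^ 2 ≤ 153 / 100 * N := hI2
      have hπε : (3 : ℝ) * 20 ≤ Real.pi * ε⁻¹ := mul_le_mul hπ.le hinv (by norm_num) (by positivity)
      have h4 : (3 : ℝ) * 20 * N ≤ Real.pi * ε⁻¹ * N := mul_le_mul_of_nonneg_right hπε hNpos.le
      have e4 : Real.pi * (ε⁻¹ * N) = Real.pi * ε⁻¹ * N := by ring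
      rw [e4]
      linarith
    have h := stub_archBathtub φε hφεW hn1pos hcond
    rw [hn1, hn2] at h
    rw [hWd, hψε]
    exact h
  -- Step 3: the polar bound `Re P ≥ −2 F0 F1 ‖A₋‖ ‖A₊‖` and the Cauchy–Schwarz bounds on `A∓`
  have hP : -(2 * (F0 * F1 * (‖Aminus‖ * ‖Aplus‖))) ≤
      2 * (weilMellin φε 0 * conj (weilMellin φε 1) * (Aminus * conj Aplus)).re := by
    have hn : ‖weilMellin φε 0 * conj (weilMellin φε 1) * (Aminus * conj Aplus)‖ =
        F0 * F1 * (‖Aminus‖ * ‖Aplus‖) := by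
      rw [norm_mul, norm_mul, norm_mul, Complex.norm_conj, Complex.norm_conj]
    have h := Complex.abs_re_le_norm (weilMellin φε 0 * conj (weilMellin φε 1) * (Aminus * conj Aplus))
    rw [hn] at h
    have := (abs_le.1 h).1
    linarith
  have hnAm2 : ‖Aminus‖ ^ 2 ≤ (1 + Real.log M) * L := by
    have hle : ‖Aminus‖ ≤ ∑ m ∈ Finset.Icc 1 M, ‖a m‖ * (Real.sqrt (m : ℝ))⁻¹ := by
      rw [hAminus]
      refine (norm_sum_le _ _).trans (le_of_eq (Finset.sum_congr rfl fun m hm => ?_))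
      rw [norm_mul, norm_inv, Complex.norm_real, Real.norm_eq_abs, abs_of_nonneg (Real.sqrt_nonneg _)]
    have hcs := Finset.sum_mul_sq_le_sq_mul_sq (Finset.Icc 1 M) (fun m => ‖a m‖)
      (fun m => (Real.sqrt (m : ℝ))⁻¹)
    have hsq : ∑ m ∈ Finset.Icc 1 M, ((Real.sqrt (m : ℝ))⁻¹) ^ 2 = ∑ m ∈ Finset.Icc 1 M, ((m : ℝ))⁻¹ := by
      refine Finset.sum_congr rfl fun m hm => ?_
      have hm0 : (0 : ℝ) ≤ (m : ℝ) := by positivity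
      rw [inv_pow, Real.sq_sqrt hm0]
    rw [hsq] at hcs
    calc ‖Aminus‖ ^ 2 ≤ (∑ m ∈ Finset.Icc 1 M, ‖a m‖ * (Real.sqrt (m : ℝ))⁻¹) ^ 2 :=
          pow_le_pow_left₀ (norm_nonneg _) hle 2
      _ ≤ (∑ m ∈ Finset.Icc 1 M, ‖a m‖ ^ 2) * ∑ m ∈ Finset.Icc 1 M, ((m : ℝ))⁻¹ := hcs
      _ ≤ (∑ m ∈ Finset.Icc 1 M, ‖a m‖ ^ 2) * (1 + Real.log M) :=
          mul_le_mul_of_nonneg_left (sum_Icc_inv_le_w20 M) (Finset.sum_nonneg fun _ _ => by positivity)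
      _ = (1 + Real.log M) * L := by rw [hL]; ring
  have hnAp2 : ‖Aplus‖ ^ 2 ≤ (M : ℝ) * Q1 := by
    have hle : ‖Aplus‖ ≤ ∑ m ∈ Finset.Icc 1 M, ‖a m‖ * Real.sqrt m * 1 := by
      rw [hAplus]
      refine (norm_sum_le _ _).trans (le_of_eq (Finset.sum_congr rfl fun m hm => ?_))
      rw [norm_mul, Complex.norm_real, Real.norm_eq_abs, abs_of_nonneg (Real.sqrt_nonneg _), mul_one]
    have hcs := Finset.sum_mul_sq_le_sq_mul_sq (Finset.Icc 1 M) (fun m => ‖a m‖ * Real.sqrt m)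
      (fun _ => (1 : ℝ))
    have hsq : ∑ m ∈ Finset.Icc 1 M, (‖a m‖ * Real.sqrt m) ^ 2 = Q1 := by
      rw [hQ1]
      refine Finset.sum_congr rfl fun m hm => ?_
      have hm0 : (0 : ℝ) ≤ m := by positivity
      rw [mul_pow, Real.sq_sqrt hm0]
      ring
    have hone : ∑ _m ∈ Finset.Icc 1 M, (1 : ℝ) ^ 2 = M := by simp
    rw [hsq, hone] at hcs
    calc ‖Aplus‖ ^ 2 ≤ (∑ m ∈ Finset.Icc 1 M, ‖a m‖ * Real.sqrt m * 1) ^ 2 :=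
          pow_le_pow_left₀ (norm_nonneg _) hle 2
      _ ≤ Q1 * M := hcs
      _ = (M : ℝ) * Q1 := by ring
  -- Step 4: `(log M + 1) Q₁ ≤ Q' + M L` (termwise `m(1 + log(M/m)) ≤ M`)
  have hQ1le : (Real.log M + 1) * Q1 ≤ Qp + M * L := by
    rw [hQ1, hQp, hL, Finset.mul_sum, Finset.mul_sum, ← Finset.sum_add_distrib]
    refine Finset.sum_le_sum fun m hm => ?_
    have hm1 : (1 : ℝ) ≤ m := by exact_mod_cast (Finset.mem_Icc.1 hm).1
    have hmM : (m : ℝ) ≤ M := by exact_mod_cast (Finset.mem_Icc.1 hm).2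
    have hm0 : (0 : ℝ) < m := by linarith
    -- `log M − log m ≤ M/m − 1`
    have hlog' : Real.log M - Real.log m ≤ (M : ℝ) / m - 1 := by
      rw [← Real.log_div hMr0.ne' hm0.ne']
      exact Real.log_le_sub_one_of_pos (by positivity)
    have hkey : (m : ℝ) * (Real.log M + 1) ≤ (m : ℝ) * Real.log m + M := by
      have h := mul_le_mul_of_nonneg_left hlog' hm0.le
      have e : (m : ℝ) * ((M : ℝ) / m - 1) = M - m := by field_simp
      rw [e, mul_sub] at h
      linarith
    have ha0 : 0 ≤ ‖a m‖ ^ 2 := by positivity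
    have h' := mul_le_mul_of_nonneg_right hkey ha0
    calc (Real.log M + 1) * ((m : ℝ) * ‖a m‖ ^ 2) = (m : ℝ) * (Real.log M + 1) * ‖a m‖ ^ 2 := by ring
      _ ≤ ((m : ℝ) * Real.log m + M) * ‖a m‖ ^ 2 := h'
      _ = (m : ℝ) * Real.log m * ‖a m‖ ^ 2 + M * ‖a m‖ ^ 2 := by ring
  -- Step 5: split the archimedean Gram form into diagonal and off-diagonal parts
  have hdiagsplit : (weilArchTerm (weilConv (fun x : ℝ => ∑ m ∈ Finset.Icc 1 M,
        a m * ((ε : ℂ)⁻¹ * ((expNegInvGlue (1 - ((x - Real.log (m : ℝ)) / ε) ^ 2) : ℝ) : ℂ)))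
      (weilReflect (fun x : ℝ => ∑ m ∈ Finset.Icc 1 M,
        a m * ((ε : ℂ)⁻¹ * ((expNegInvGlue (1 - ((x - Real.log (m : ℝ)) / ε) ^ 2) : ℝ) : ℂ)))))).re =
      L * Wd + Off := by
    rw [h3]
    have hT0 : ∀ h : ℝ → ℂ, weilTranslate h 0 = h := fun h => funext fun t => by simp [weilTranslate]
    have e : ∀ m ∈ Finset.Icc 1 M,
        ∑ m' ∈ Finset.Icc 1 M, a m * conj (a m') *
            weilArchTerm (weilTranslate ψε (Real.log (m : ℝ) - Real.log (m' : ℝ))) =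
          ((‖a m‖ ^ 2 : ℝ) : ℂ) * weilArchTerm ψε +
            ∑ m' ∈ (Finset.Icc 1 M).erase m, a m * conj (a m') *
              weilArchTerm (weilTranslate ψε (Real.log (m : ℝ) - Real.log (m' : ℝ))) := by
      intro m hm
      rw [← Finset.add_sum_erase _ _ hm, sub_self, hT0, Complex.mul_conj']
      push_cast
      ring
    rw [Finset.sum_congr rfl e, Finset.sum_add_distrib, Complex.add_re, Complex.re_sum]
    congr 1
    rw [hL, Finset.sum_mul]
    refine Finset.sum_congr rfl fun m _ => ?_
    rw [Complex.re_ofReal_mul]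
  -- Step 6: assemble
  have hQ : (weilQuadratic (fun x : ℝ => ∑ m ∈ Finset.Icc 1 M,
        a m * ((ε : ℂ)⁻¹ * ((expNegInvGlue (1 - ((x - Real.log (m : ℝ)) / ε) ^ 2) : ℝ) : ℂ)))).re =
      2 * (weilMellin φε 0 * conj (weilMellin φε 1) * (Aminus * conj Aplus)).re - ε⁻¹ * N * H +
        (L * Wd + Off) := by
    rw [h1, h2, hdiagsplit]
  exact assemble_inv20 (ε := ε) (Mr := (M : ℝ)) (N := N) (I := I) (L := L) (D := D) (Qp := Qp) (Q1 := Q1)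
    (V := V) (H := H) (Wd := Wd) (Off := Off) (F0 := F0) (F1 := F1) (nAm := ‖Aminus‖) (nAp := ‖Aplus‖)
    hε hMr hlam hNpos hIpos hI2
    (Finset.sum_nonneg fun _ _ => by positivity)
    (Finset.sum_nonneg fun _ _ => Finset.sum_nonneg fun _ _ =>
      mul_nonneg ArithmeticFunction.vonMangoldt_nonneg (by positivity))
    (Finset.sum_nonneg fun _ _ => by positivity)
    hQ1le hPoinc hV' hId hQ (norm_nonneg _) hF0le hF1le
    (norm_nonneg _) (norm_nonneg _) hnAm2 hnAp2 hP hbath hOff'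

/-- **`stub_windowCore` on the sub-band `εM ≤ 1/20`.** For `ε > 0`, `M ≥ 1`, `a` with `1/40 < εM`, `2ε(M+1) ≤ 1`
and `εM ≤ 1/20`, the signed normal form of Theorem B holds:
`ε⁻¹‖φ₀‖₂² (H(a) + log π ‖a‖²) ≤ 2 Re(φ̂_ε(0) conj φ̂_ε(1) · A₋ conj A₊) + (1/2π) ∫ |φ̂_ε(1/2+it)|² |D_a(t)|² Re ψ(1/4+it/2) dt`
(from `combWindow_le_inv20` by the exact window identity, the polar identity, W1, W2 and
`weilArchIntegral_weilConv_weilReflect`; the hypothesis `1/40 < εM` is not used). [folklore] -/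
theorem stub_windowCore_of_le_inv20 : ∀ ε : ℝ, 0 < ε → ∀ (M : ℕ) (a : ℕ → ℂ), 1 ≤ M → 1 / 40 < ε * M →
    2 * ε * ((M : ℝ) + 1) ≤ 1 → ε * M ≤ 1 / 20 →
    ε⁻¹ * weilNorm2Sq (fun u : ℝ => ((expNegInvGlue (1 - u ^ 2) : ℝ) : ℂ)) *
        (2 * (∑ m ∈ Finset.Icc 1 M, ∑ n ∈ Finset.Icc 1 (M / m),
            ((ArithmeticFunction.vonMangoldt n : ℝ) : ℂ) / (Real.sqrt n : ℂ) * a (n * m) *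
              conj (a m)).re
          + Real.log Real.pi * ∑ m ∈ Finset.Icc 1 M, ‖a m‖ ^ 2) ≤
      2 * (weilMellin (fun t : ℝ => (ε : ℂ)⁻¹ * ((expNegInvGlue (1 - (t / ε) ^ 2) : ℝ) : ℂ)) 0 *
            conj (weilMellin (fun t : ℝ => (ε : ℂ)⁻¹ * ((expNegInvGlue (1 - (t / ε) ^ 2) : ℝ) : ℂ)) 1) *
          ((∑ m ∈ Finset.Icc 1 M, a m * ((Real.sqrt (m : ℝ) : ℝ) : ℂ)⁻¹) *
            conj (∑ m ∈ Finset.Icc 1 M, a m * ((Real.sqrt (m : ℝ) : ℝ) : ℂ)))).re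
      + 1 / (2 * Real.pi) * ∫ t : ℝ,
          ‖weilMellin (fun t : ℝ => (ε : ℂ)⁻¹ * ((expNegInvGlue (1 - (t / ε) ^ 2) : ℝ) : ℂ))
              (1 / 2 + t * I)‖ ^ 2 *
            ‖∑ m ∈ Finset.Icc 1 M, a m * cexp (t * I * (Real.log (m : ℝ) : ℂ))‖ ^ 2 *
            (Complex.digamma (1 / 4 + t / 2 * I)).re := by
  intro ε hε M a hM _ hw h20
  -- names
  set g : ℝ → ℂ := fun x : ℝ => ∑ m ∈ Finset.Icc 1 M,
      a m * ((ε : ℂ)⁻¹ * ((expNegInvGlue (1 - ((x - Real.log (m : ℝ)) / ε) ^ 2) : ℝ) : ℂ)) with hg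
  set φε : ℝ → ℂ := fun t : ℝ => (ε : ℂ)⁻¹ * ((expNegInvGlue (1 - (t / ε) ^ 2) : ℝ) : ℂ) with hφε
  set N : ℝ := weilNorm2Sq (fun u : ℝ => ((expNegInvGlue (1 - u ^ 2) : ℝ) : ℂ)) with hN
  set H : ℝ := 2 * (∑ m ∈ Finset.Icc 1 M, ∑ n ∈ Finset.Icc 1 (M / m),
      ((ArithmeticFunction.vonMangoldt n : ℝ) : ℂ) / (Real.sqrt n : ℂ) * a (n * m) *
        conj (a m)).re with hH
  set L : ℝ := ∑ m ∈ Finset.Icc 1 M, ‖a m‖ ^ 2 with hL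
  set P : ℝ := 2 * (weilMellin φε 0 * conj (weilMellin φε 1) *
      ((∑ m ∈ Finset.Icc 1 M, a m * ((Real.sqrt (m : ℝ) : ℝ) : ℂ)⁻¹) *
        conj (∑ m ∈ Finset.Icc 1 M, a m * ((Real.sqrt (m : ℝ) : ℝ) : ℂ)))).re with hP
  set D : ℝ → ℂ := fun t : ℝ => ∑ m ∈ Finset.Icc 1 M, a m * cexp (t * I * (Real.log (m : ℝ) : ℂ)) with hD
  set J : ℝ := ∫ t : ℝ, ‖weilMellin φε (1 / 2 + t * I)‖ ^ 2 * ‖D t‖ ^ 2 *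
      (Complex.digamma (1 / 4 + t / 2 * I)).re with hJ
  -- the window cell
  have hQ : 0 ≤ (weilQuadratic g).re := combWindow_le_inv20 ε hε M a h20
  -- the comb is a Weil test
  have hgW : IsWeilTest g :=
    Summit.RiemannHypothesis.RiemannHypothesis.Theorems.weilComb_shapeComb_isWeilTest ε M a
  -- Step 1: exact window identity and polar identity
  have h1 := weilQuadratic_comb_re_exactWindow ε hε M a hM hw
  have h2 := weilPolarTerm_comb_re ε hε M a
  -- Step 2: the archimedean term of `g ⋆ g̃`
  have h3 : (weilArchTerm (weilConv g (weilReflect g))).re =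
      1 / (2 * Real.pi) * (∫ t : ℝ, ‖weilMellin g (1 / 2 + t * I)‖ ^ 2 *
        (Complex.digamma (1 / 4 + t / 2 * I)).re) - weilNorm2Sq g * Real.log Real.pi := by
    unfold weilArchTerm
    rw [weilArchIntegral_weilConv_weilReflect hgW, weilConv_weilReflect_apply_zero]
    have e : ((1 / (2 * Real.pi) : ℂ) * ((∫ t : ℝ, ‖weilMellin g (1 / 2 + t * I)‖ ^ 2 *
          (Complex.digamma (1 / 4 + t / 2 * I)).re : ℝ) : ℂ) -
          ((∫ t : ℝ, ‖g t‖ ^ 2 : ℝ) : ℂ) * (Real.log Real.pi : ℂ)) =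
        ((1 / (2 * Real.pi) * (∫ t : ℝ, ‖weilMellin g (1 / 2 + t * I)‖ ^ 2 *
          (Complex.digamma (1 / 4 + t / 2 * I)).re) - weilNorm2Sq g * Real.log Real.pi : ℝ) : ℂ) := by
      unfold weilNorm2Sq
      push_cast
      ring
    rw [e, Complex.ofReal_re]
  -- Step 3: `|ĝ(1/2+it)|² = |φ̂_ε(1/2+it)|² |D_a(t)|²` under the integral
  have h4 : (∫ t : ℝ, ‖weilMellin g (1 / 2 + t * I)‖ ^ 2 * (Complex.digamma (1 / 4 + t / 2 * I)).re) = J := by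
    rw [hJ]
    congr 1
    funext t
    rw [hg, stub_windowMellin ε hε M a t, norm_mul, mul_pow]
    ring
  -- Step 4: the window norm identity
  have h5 : weilNorm2Sq g = ε⁻¹ * N * L := by
    rw [hg, hN, hL]
    exact stub_windowNorm ε hε M a hw
  -- Step 5: read off the normal form
  rw [h1, h2, h3, h4, h5] at hQ
  have e6 : ε⁻¹ * N * (H + Real.log Real.pi * L) = ε⁻¹ * N * H + ε⁻¹ * N * L * Real.log Real.pi := by ring
  show ε⁻¹ * N * (H + Real.log Real.pi * L) ≤ P + 1 / (2 * Real.pi) * J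
  rw [e6]
  have hQ' : 0 ≤ P - ε⁻¹ * N * H + (1 / (2 * Real.pi) * J - ε⁻¹ * N * L * Real.log Real.pi) := hQ
  linarith

end Summit.RiemannHypothesis.RiemannHypothesis.Theorems.WeilCombBohrFejer

end
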